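import Literature.MathematicalPhysics.QuantumManyBody.SubordinatedPointCharges
import HarnessLib

/-!
# The long-distance cutoff error of Lieb–Solovej: `Y_a - Y_b` costs at most `½ n (b - a)`

Topic `Literature/MathematicalPhysics/QuantumManyBody` (electrostatics groundwork for the charged
Bose gas, `JelliumBoseGas.foldyLaw`; continuation of `SubordinatedPointCharges.lean`).
[LiebSolovej2001, §4 (4.1)–(4.3)]: replacing the Yukawa kernel `Y_{ω/ℓ}` by the long-distance
cut-off `V_R = Y_{R⁻¹}` (`Y_m(x) = e^{-m|x|}/|x|`, `ω/ℓ ≤ R⁻¹`) changes the jellium energy of the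
`n` (smeared) point charges and the background by the energy in the kernel
`K = Y_{ω/ℓ} - V_R`, which "defines a positive semi-definite kernel. Note, moreover, that
`(Y_{ω/ℓ} - V_R)(0) = R⁻¹ - ω/ℓ ≤ R⁻¹`. Thus [the difference] `≥ -½ n (Y_{ω/ℓ} - V_R)(0) = -½ n R⁻¹`"
[LiebSolovej2001, (4.3)]. Here, for `0 < a ≤ b`, the kernel `Y_a - Y_b` is exhibited as the
subordinated kernel `4π K_w`, `w(s) = e^{-a²s} - e^{-b²s} ∈ [0, 1]`
(`Coulomb.integral_Ioi_exp_neg_mul_heatKernel`: `∫₀^∞ e^{-μs} G_s(z) ds = e^{-√μ|z|}/(4π|z|)`), its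
value at the origin is computed, `K_w(0) = ∫₀^∞ (e^{-a²s} - e^{-b²s})(4πs)^{-3/2} ds = (b - a)/(4π)`
(Tonelli on `e^{-αs} - e^{-βs} = ∫_α^β s e^{-us} du` and `∫₀^∞ s^{-1/2}e^{-us} ds = √(π/u)`), and
`Coulomb.subordinated_points_ge` gives, for charges `cᵢ ∈ ℝ` at `xᵢ ∈ ℝ³` and a background
`g ∈ L¹(ℝ³)`,

**`∑_{i<j} cᵢcⱼ K(xᵢ - xⱼ) - ∑ᵢ cᵢ ∫ g(y) K(xᵢ - y) dy + ½∬ g g K ≥ -½ · (b - a)/(4π) · ∑ᵢ cᵢ²`,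
`K = (Y_a - Y_b)/(4π)`** — with `cᵢ = χ_ℓ(xᵢ) ∈ [0, 1]`, `g = ρχ_ℓ`, `a = ω/ℓ`, `b = R⁻¹` this is
(4.3) (in units where the Coulomb kernel is `(4π|x|)⁻¹`; multiply by `4π` for `|x|⁻¹`).

* `Coulomb.exp_sub_exp_eq_integral` — `e^{-αs} - e^{-βs} = ∫_α^β s e^{-us} du`.
* `Coulomb.lintegral_rpow_neg_half_mul_exp` — `∫₀^∞ s^{-1/2} e^{-us} ds = √π/√u` (`ℝ≥0∞`).
* `Coulomb.lintegral_exp_sub_exp_mul_rpow` — `∫₀^∞ (e^{-αs} - e^{-βs}) s^{-3/2} ds = 2√π(√β - √α)`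
  for `0 < α ≤ β` (`ℝ≥0∞`).
* `Coulomb.yukawaDiff_weight_nonneg/le_one`, `integral_yukawaDiff_weight_heatKernel_zero` —
  the weight `w(s) = e^{-a²s} - e^{-b²s}` and **`K_w(0) = (b - a)/(4π)`** with integrability.
* `Coulomb.yukawaDiff_kernel_eq` — `K_w(z) = (e^{-a|z|} - e^{-b|z|})/(4π|z|)` for `z ≠ 0`.
* `Coulomb.yukawaCutoff_points_ge` — **the displayed bound** [LiebSolovej2001, (4.3)].

## References

* [LiebSolovej2001] E. H. Lieb, J. P. Solovej, Commun. Math. Phys. 217 (2001) 127–163, §4,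
  (4.1)–(4.3) and Lemma 4.1 (arXiv:cond-mat/0007425, p. 10).
-/

noncomputable section

open MeasureTheory Set Filter Real
open scoped ENNReal NNReal Topology
open Literature.Analysis.UnboundedOperators

namespace Literature.MathematicalPhysics.QuantumManyBody.Coulomb

open BoseGas

/-! ### `∫₀^∞ (e^{-αs} - e^{-βs}) s^{-3/2} ds = 2√π (√β - √α)` -/

/-- `e^{-αs} - e^{-βs} = ∫_α^β s e^{-us} du` (fundamental theorem of calculus). [folklore] -/
theorem exp_sub_exp_eq_integral (α β s : ℝ) :
    Real.exp (-(α * s)) - Real.exp (-(β * s)) = ∫ u in α..β, s * Real.exp (-(u * s)) := by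
  have hderiv : ∀ u ∈ uIcc α β,
      HasDerivAt (fun u : ℝ => -Real.exp (-(u * s))) (s * Real.exp (-(u * s))) u := by
    intro u _
    have h1 : HasDerivAt (fun u : ℝ => -(u * s)) (-s) u := (hasDerivAt_mul_const s).neg
    have h3 := h1.exp.neg
    exact h3.congr_deriv (by ring)
  have hint : IntervalIntegrable (fun u : ℝ => s * Real.exp (-(u * s))) volume α β :=
    (Continuous.intervalIntegrable (by fun_prop) _ _)
  rw [intervalIntegral.integral_eq_sub_of_hasDerivAt hderiv hint]
  ring

/-- `∫₀^∞ s^{-1/2} e^{-us} ds = √π/√u` for `u > 0` (`Γ(½) = √π`), `ℝ≥0∞` form with integrability.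
[folklore] -/
theorem lintegral_rpow_neg_half_mul_exp {u : ℝ} (hu : 0 < u) :
    IntegrableOn (fun s : ℝ => s ^ (-(1 / 2 : ℝ)) * Real.exp (-(u * s))) (Ioi 0) ∧
      ∫⁻ s in Ioi (0 : ℝ), ENNReal.ofReal (s ^ (-(1 / 2 : ℝ)) * Real.exp (-(u * s))) =
        ENNReal.ofReal (Real.sqrt π / Real.sqrt u) := by
  have hval : ∫ s in Ioi (0 : ℝ), s ^ (-(1 / 2 : ℝ)) * Real.exp (-(u * s)) =
      Real.sqrt π / Real.sqrt u := by
    have h := Real.integral_rpow_mul_exp_neg_mul_Ioi (a := 1 / 2) (r := u) (by norm_num) hu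
    rw [show (1 / 2 : ℝ) - 1 = -(1 / 2) by norm_num, Real.Gamma_one_half_eq] at h
    rw [h, Real.sqrt_eq_rpow u, one_div u, Real.inv_rpow hu.le]
    ring
  have hpos : 0 < Real.sqrt π / Real.sqrt u := by positivity
  have hint : IntegrableOn (fun s : ℝ => s ^ (-(1 / 2 : ℝ)) * Real.exp (-(u * s))) (Ioi 0) := by
    by_contra h
    rw [IntegrableOn] at h
    rw [integral_undef h] at hval
    exact hpos.ne hval
  refine ⟨hint, ?_⟩
  rw [← hval, ofReal_integral_eq_lintegral_ofReal hint]
  exact (ae_restrict_iff' measurableSet_Ioi).2 (Eventually.of_forall fun s hs =>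
    mul_nonneg (Real.rpow_nonneg (le_of_lt hs) _) (Real.exp_pos _).le)

/-- **`∫₀^∞ (e^{-αs} - e^{-βs}) s^{-3/2} ds = 2√π (√β - √α)`** for `0 < α ≤ β` (`ℝ≥0∞` form):
Tonelli on `(e^{-αs} - e^{-βs}) s^{-3/2} = ∫_α^β s^{-1/2} e^{-us} du` and
`∫₀^∞ s^{-1/2}e^{-us} ds = √π u^{-1/2}`, `∫_α^β u^{-1/2} du = 2(√β - √α)`. [folklore] -/
theorem lintegral_exp_sub_exp_mul_rpow {α β : ℝ} (hα : 0 < α) (hαβ : α ≤ β) :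
    ∫⁻ s in Ioi (0 : ℝ), ENNReal.ofReal ((Real.exp (-(α * s)) - Real.exp (-(β * s))) * s ^ (-(3 / 2 : ℝ))) =
      ENNReal.ofReal (2 * Real.sqrt π * (Real.sqrt β - Real.sqrt α)) := by
  have hβ : 0 < β := hα.trans_le hαβ
  -- Step 1: the integrand as a `u`-integral
  have step1 : ∀ s ∈ Ioi (0 : ℝ),
      ENNReal.ofReal ((Real.exp (-(α * s)) - Real.exp (-(β * s))) * s ^ (-(3 / 2 : ℝ))) =
        ∫⁻ u in Ioc α β, ENNReal.ofReal (s ^ (-(1 / 2 : ℝ)) * Real.exp (-(u * s))) := by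
    intro s hs
    have hs0 : (0 : ℝ) < s := hs
    have hid : (Real.exp (-(α * s)) - Real.exp (-(β * s))) * s ^ (-(3 / 2 : ℝ)) =
        ∫ u in Ioc α β, s ^ (-(1 / 2 : ℝ)) * Real.exp (-(u * s)) := by
      rw [exp_sub_exp_eq_integral, intervalIntegral.integral_of_le hαβ, ← integral_mul_const]
      refine setIntegral_congr_fun measurableSet_Ioc fun u _ => ?_
      have e : s ^ (-(1 / 2 : ℝ)) = s * s ^ (-(3 / 2 : ℝ)) := by
        rw [show (-(1 / 2 : ℝ)) = 1 + -(3 / 2) by norm_num, Real.rpow_add hs0, Real.rpow_one]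
      rw [e]
      ring
    rw [hid]
    refine ofReal_integral_eq_lintegral_ofReal ?_ ?_
    · exact (Continuous.integrableOn_Icc (by fun_prop)).mono_set Ioc_subset_Icc_self
    · exact (ae_restrict_iff' measurableSet_Ioc).2 (Eventually.of_forall fun u _ =>
        mul_nonneg (Real.rpow_nonneg hs0.le _) (Real.exp_pos _).le)
  rw [setLIntegral_congr_fun measurableSet_Ioi step1]
  -- Step 2: Tonelli
  have hmeas : Measurable fun q : ℝ × ℝ =>
      ENNReal.ofReal (q.1 ^ (-(1 / 2 : ℝ)) * Real.exp (-(q.2 * q.1))) :=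
    ENNReal.measurable_ofReal.comp ((measurable_fst.pow_const _).mul
      (Real.measurable_exp.comp (measurable_snd.mul measurable_fst).neg))
  rw [lintegral_lintegral_swap hmeas.aemeasurable]
  -- Step 3: the inner Gamma integrals
  have step3 : ∀ u ∈ Ioc α β, ∫⁻ s in Ioi (0 : ℝ),
      ENNReal.ofReal (s ^ (-(1 / 2 : ℝ)) * Real.exp (-(u * s))) =
        ENNReal.ofReal (Real.sqrt π * u ^ (-(1 / 2 : ℝ))) := by
    intro u hu
    have hu0 : 0 < u := hα.trans hu.1
    rw [(lintegral_rpow_neg_half_mul_exp hu0).2, Real.sqrt_eq_rpow u, Real.rpow_neg hu0.le,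
      div_eq_mul_inv]
  rw [setLIntegral_congr_fun measurableSet_Ioc step3]
  -- Step 4: `∫_α^β √π u^{-1/2} du = 2√π(√β - √α)`
  have hint : IntegrableOn (fun u : ℝ => Real.sqrt π * u ^ (-(1 / 2 : ℝ))) (Ioc α β) := by
    refine (ContinuousOn.integrableOn_Icc ?_).mono_set Ioc_subset_Icc_self
    exact continuousOn_const.mul (ContinuousOn.rpow_const continuousOn_id fun u hu =>
      Or.inl (ne_of_gt (hα.trans_le hu.1)))
  rw [← ofReal_integral_eq_lintegral_ofReal hint ((ae_restrict_iff' measurableSet_Ioc).2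
    (Eventually.of_forall fun u hu => mul_nonneg (Real.sqrt_nonneg _)
      (Real.rpow_nonneg (hα.trans hu.1).le _)))]
  congr 1
  rw [integral_const_mul, ← intervalIntegral.integral_of_le hαβ,
    integral_rpow (Or.inr ⟨by norm_num, fun h0 => ?_⟩)]
  · rw [show (-(1 / 2 : ℝ) + 1) = 1 / 2 by norm_num, ← Real.sqrt_eq_rpow, ← Real.sqrt_eq_rpow]
    ring
  · -- `0 ∉ [α, β]`
    rw [mem_uIcc] at h0
    rcases h0 with ⟨h1, _⟩ | ⟨h1, _⟩
    · linarith
    · linarith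

/-! ### The weight `w(s) = e^{-a²s} - e^{-b²s}` and `K_w(0) = (b - a)/(4π)` -/

/-- The weight of the Yukawa difference is nonnegative on `(0, ∞)` for `a² ≤ b²`. [folklore] -/
theorem yukawaDiff_weight_nonneg {a b : ℝ} (hab : a ^ 2 ≤ b ^ 2) (s : ℝ) (hs : 0 < s) :
    0 ≤ Real.exp (-(a ^ 2 * s)) - Real.exp (-(b ^ 2 * s)) := by
  have : Real.exp (-(b ^ 2 * s)) ≤ Real.exp (-(a ^ 2 * s)) :=
    Real.exp_le_exp.2 (by nlinarith)
  linarith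

/-- The weight of the Yukawa difference is at most `1`. [folklore] -/
theorem yukawaDiff_weight_le_one (a b s : ℝ) (hs : 0 < s) :
    Real.exp (-(a ^ 2 * s)) - Real.exp (-(b ^ 2 * s)) ≤ 1 := by
  have h1 : Real.exp (-(a ^ 2 * s)) ≤ 1 := Real.exp_le_one_iff.2 (by nlinarith [sq_nonneg a])
  have h2 : 0 < Real.exp (-(b ^ 2 * s)) := Real.exp_pos _
  linarith

/-- **`K_w(0) = (b - a)/(4π)`** for `w(s) = e^{-a²s} - e^{-b²s}`, `0 < a ≤ b`: the function
`s ↦ w(s) G_s(0)` is integrable on `(0, ∞)` with integral `(b - a)/(4π)` (`G_s(0) = (4πs)^{-3/2}`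
and `lintegral_exp_sub_exp_mul_rpow`). [cite: LiebSolovej2001, §4 (4.3)] -/
theorem integral_yukawaDiff_weight_heatKernel_zero {a b : ℝ} (ha : 0 < a) (hab : a ≤ b) :
    IntegrableOn (fun s : ℝ =>
        (Real.exp (-(a ^ 2 * s)) - Real.exp (-(b ^ 2 * s))) * heatKernel s (0 : Space)) (Ioi 0) ∧
      ∫ s in Ioi (0 : ℝ), (Real.exp (-(a ^ 2 * s)) - Real.exp (-(b ^ 2 * s))) * heatKernel s (0 : Space) =
        (b - a) / (4 * π) := by
  have hb : 0 < b := ha.trans_le hab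
  have hab2 : a ^ 2 ≤ b ^ 2 := by nlinarith
  set F : ℝ → ℝ := fun s =>
    (Real.exp (-(a ^ 2 * s)) - Real.exp (-(b ^ 2 * s))) * heatKernel s (0 : Space) with hF
  have hFm : Measurable F :=
    ((Real.measurable_exp.comp (measurable_const.mul measurable_id).neg).sub
      (Real.measurable_exp.comp (measurable_const.mul measurable_id).neg)).mul
      (measurable_heatKernel_left 0)
  have hnn : ∀ s ∈ Ioi (0 : ℝ), 0 ≤ F s := fun s hs =>
    mul_nonneg (yukawaDiff_weight_nonneg hab2 s hs) (heatKernel_pos hs _).le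
  -- the lintegral
  have hlin : ∫⁻ s in Ioi (0 : ℝ), ENNReal.ofReal (F s) = ENNReal.ofReal ((b - a) / (4 * π)) := by
    have e : ∀ s ∈ Ioi (0 : ℝ), ENNReal.ofReal (F s) = ENNReal.ofReal ((4 * π) ^ (-(3 / 2 : ℝ))) *
        ENNReal.ofReal ((Real.exp (-(a ^ 2 * s)) - Real.exp (-(b ^ 2 * s))) * s ^ (-(3 / 2 : ℝ))) := by
      intro s hs
      have hs0 : (0 : ℝ) < s := hs
      simp only [hF]
      rw [heatKernel_zero_eq, Real.mul_rpow (by positivity) hs0.le, ← ENNReal.ofReal_mul (by positivity)]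
      congr 1
      ring
    rw [setLIntegral_congr_fun measurableSet_Ioi e, lintegral_const_mul' _ _ ENNReal.ofReal_ne_top,
      lintegral_exp_sub_exp_mul_rpow (by positivity : 0 < a ^ 2) hab2,
      ← ENNReal.ofReal_mul (by positivity), Real.sqrt_sq ha.le, Real.sqrt_sq hb.le]
    congr 1
    -- `(4π)^{-3/2} · 2√π (b - a) = (b - a)/(4π)`
    have hπ : 0 < π := Real.pi_pos
    have e3 : (4 * π) ^ (-(3 / 2 : ℝ)) = (4 * π * (2 * Real.sqrt π))⁻¹ := by
      rw [Real.rpow_neg (by positivity), show (3 / 2 : ℝ) = 1 + 1 / 2 by norm_num,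
        Real.rpow_add (by positivity), Real.rpow_one, ← Real.sqrt_eq_rpow, Real.sqrt_mul' _ hπ.le,
        show Real.sqrt 4 = 2 by rw [show (4:ℝ) = 2 ^ 2 by norm_num, Real.sqrt_sq (by norm_num)]]
    have hsπ : 0 < Real.sqrt π := Real.sqrt_pos.2 hπ
    rw [e3]
    field_simp
  have hint : IntegrableOn F (Ioi 0) := by
    refine ⟨hFm.aestronglyMeasurable, (hasFiniteIntegral_iff_ofReal ?_).2 ?_⟩
    · exact (ae_restrict_iff' measurableSet_Ioi).2 (Eventually.of_forall hnn)
    · rw [hlin]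
      exact ENNReal.ofReal_lt_top
  refine ⟨hint, ?_⟩
  rw [integral_eq_lintegral_of_nonneg_ae ((ae_restrict_iff' measurableSet_Ioi).2
    (Eventually.of_forall hnn)) hFm.aestronglyMeasurable, hlin, ENNReal.toReal_ofReal]
  exact div_nonneg (by linarith) (by positivity)

/-- **The Yukawa difference kernel by subordination**: for `0 < a ≤ b` and `z ≠ 0`,
`∫₀^∞ (e^{-a²s} - e^{-b²s}) G_s(z) ds = (e^{-a|z|} - e^{-b|z|})/(4π|z|) = (Y_a - Y_b)(z)/(4π)`.
[cite: LiebSolovej2001, §4 (4.2)] -/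
theorem yukawaDiff_kernel_eq {a b : ℝ} (ha : 0 < a) (hab : a ≤ b) {z : Space} (hz : z ≠ 0) :
    ∫ s in Ioi (0 : ℝ), (Real.exp (-(a ^ 2 * s)) - Real.exp (-(b ^ 2 * s))) * heatKernel s z =
      (Real.exp (-(a * ‖z‖)) - Real.exp (-(b * ‖z‖))) / (4 * π * ‖z‖) := by
  have hb : 0 < b := ha.trans_le hab
  obtain ⟨hia, hva⟩ := integral_Ioi_exp_neg_mul_heatKernel hz (by positivity : 0 < a ^ 2)
  obtain ⟨hib, hvb⟩ := integral_Ioi_exp_neg_mul_heatKernel hz (by positivity : 0 < b ^ 2)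
  simp_rw [sub_mul]
  rw [integral_sub hia hib, hva, hvb, Real.sqrt_sq ha.le, Real.sqrt_sq hb.le]
  ring

/-- **The long-distance cutoff error of Lieb–Solovej** [LiebSolovej2001, (4.3)]: for
`0 < a ≤ b`, charges `cᵢ ∈ ℝ` at points `xᵢ ∈ ℝ³` (not necessarily distinct) and a real measurable
background `g ∈ L¹(ℝ³)`, with the positive-type kernel
`K(z) = ∫₀^∞ (e^{-a²s} - e^{-b²s}) G_s(z) ds = (e^{-a|z|} - e^{-b|z|})/(4π|z|) = (Y_a - Y_b)(z)/(4π)`,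
`-½ · (b - a)/(4π) · ∑ᵢ cᵢ² ≤ ∑_{i<j} cᵢcⱼ K(xᵢ - xⱼ) - ∑ᵢ cᵢ ∫ g(y) K(xᵢ - y) dy + ½ ∬ g g K`.
With `cᵢ = χ_ℓ(xᵢ) ∈ [0,1]`, `g = ρχ_ℓ`, `a = ω/ℓ ≤ b = R⁻¹` (and the factor `4π` of the units)
this is `≥ -½ n (R⁻¹ - ω/ℓ) ≥ -½ n R⁻¹`. [cite: LiebSolovej2001, §4 (4.3)] -/
theorem yukawaCutoff_points_ge {a b : ℝ} (ha : 0 < a) (hab : a ≤ b) {N : ℕ} (c : Fin N → ℝ)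
    (X : Fin N → Space) {g : Space → ℝ} (hgm : Measurable g) (hg : Integrable g) :
    -(1 / 2 * ((b - a) / (4 * π)) * ∑ i, c i ^ 2) ≤
      (∑ i, ∑ j with i < j, c i * c j * ∫ s in Ioi (0 : ℝ),
          (Real.exp (-(a ^ 2 * s)) - Real.exp (-(b ^ 2 * s))) * heatKernel s (X i - X j)) -
        (∑ i, c i * ∫ y, g y * ∫ s in Ioi (0 : ℝ),
          (Real.exp (-(a ^ 2 * s)) - Real.exp (-(b ^ 2 * s))) * heatKernel s (X i - y)) +
        1 / 2 * ∫ z : Space × Space, g z.1 * g z.2 * (∫ s in Ioi (0 : ℝ),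
          (Real.exp (-(a ^ 2 * s)) - Real.exp (-(b ^ 2 * s))) * heatKernel s (z.1 - z.2))
          ∂(volume.prod volume) := by
  have hab2 : a ^ 2 ≤ b ^ 2 := by nlinarith
  obtain ⟨hK0, hval⟩ := integral_yukawaDiff_weight_heatKernel_zero ha hab
  have hwm : Measurable fun s : ℝ => Real.exp (-(a ^ 2 * s)) - Real.exp (-(b ^ 2 * s)) :=
    (Real.measurable_exp.comp (measurable_const.mul measurable_id).neg).sub
      (Real.measurable_exp.comp (measurable_const.mul measurable_id).neg)
  have h := subordinated_points_ge hwm (fun s hs => yukawaDiff_weight_nonneg hab2 s hs) hK0 c X hgm hg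
  rw [hval] at h
  exact h

end Literature.MathematicalPhysics.QuantumManyBody.Coulomb
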